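import Mathlib
import Literature.Analysis.FluidPDE.VectorCalculus

/-!
# Route `FilamentSkeletonRss` · crux `SelectionBoxRJ` (stmt-NavierStokesRegularity-21220) — rung tools:
# rescaling the regularised self-induction integral to waist units

Lane `ns-filament-19175-p1` (g7); helper file `--supports stmt-NavierStokesRegularity-21220`, route-independent.

The box measures lengths in core units (kernel `(‖·‖² + 1)^{-3/2}`); the quantitative local-induction lemma
`…RungLiaReduction.nearStraight_liaReduction` is useful only in WAIST units (lengths `/√Γ`, core `e = 1/√Γ`), where the
Taylor window is `O(1)` waists and the `log √Γ` of local induction appears as `arsinh(δ/e)`.  This file provides the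
change of units for a curve `x` and its rescaling `X s = G⁻¹ • x (G s)` (`G > 0`):

* `rescale_deriv`, `rescale_deriv2` — `X′ s = x′(G s)`, `X″ s = G • x″(G s)`;
* `rescale_kernel` — `((‖G⁻¹•a‖² + G⁻²)^{3/2})⁻¹ = G³ ((‖a‖² + 1)^{3/2})⁻¹`;
* `selfInduction_rescale` — `∫ ((‖x t − x u‖²+1)^{3/2})⁻¹ • x′u × (x t − x u) du
   = G⁻¹ • ∫ ((‖X(t/G) − X s‖² + G⁻²)^{3/2})⁻¹ • X′s × (X(t/G) − X s) ds`.

HONEST FRAMING.  Elementary change of variables for the rung ladder of a HYPOTHETICAL filament box; nothing here is a claim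
about Navier–Stokes regularity or blow-up.
-/

set_option linter.dupNamespace false -- `Theorems.…Theorems`-style path/namespace repetition is the tree convention

noncomputable section

namespace Summit.NavierStokesRegularity.NavierStokesRegularity.Theorems

open Set Function Filter MeasureTheory Real
open Literature.Analysis.FluidPDE
open scoped InnerProductSpace Topology

namespace SelectionBoxRJRung

/-- `X′ s = x′(G s)` for `X s = G⁻¹ • x (G s)`, `G ≠ 0`, `x` differentiable. [folklore] -/
theorem rescale_hasDerivAt {x : ℝ → EuclideanSpace ℝ (Fin 3)} (hx : Differentiable ℝ x) {G : ℝ} (hG : G ≠ 0) (s : ℝ) :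
    HasDerivAt (fun s : ℝ => G⁻¹ • x (G * s)) (deriv x (G * s)) s := by
  have h1 : HasDerivAt (fun s : ℝ => G * s) G s := by simpa using (hasDerivAt_id s).const_mul G
  have h2 := ((hx (G * s)).hasDerivAt).scomp s h1
  have h3 := h2.const_smul G⁻¹
  have he : G⁻¹ • (G • deriv x (G * s)) = deriv x (G * s) := by rw [smul_smul, inv_mul_cancel₀ hG, one_smul]
  rw [he] at h3
  exact h3

/-- `deriv X = x′ ∘ (G·)`. [folklore] -/
theorem rescale_deriv {x : ℝ → EuclideanSpace ℝ (Fin 3)} (hx : Differentiable ℝ x) {G : ℝ} (hG : G ≠ 0) :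
    deriv (fun s : ℝ => G⁻¹ • x (G * s)) = fun s => deriv x (G * s) :=
  funext fun s => (rescale_hasDerivAt hx hG s).deriv

/-- `X″ s = G • x″(G s)` for `x` of class `C²`. [folklore] -/
theorem rescale_deriv2 {x : ℝ → EuclideanSpace ℝ (Fin 3)} (hx : ContDiff ℝ 2 x) {G : ℝ} (hG : G ≠ 0) (s : ℝ) :
    deriv (deriv (fun s : ℝ => G⁻¹ • x (G * s))) s = G • deriv (deriv x) (G * s) := by
  have hxd : Differentiable ℝ x := hx.differentiable (by norm_num)
  have hxd2 : Differentiable ℝ (deriv x) := hx.differentiable_deriv_two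
  rw [rescale_deriv hxd hG]
  have h1 : HasDerivAt (fun s : ℝ => G * s) G s := by simpa using (hasDerivAt_id s).const_mul G
  exact (((hxd2 (G * s)).hasDerivAt).scomp s h1).deriv

/-- The rescaled curve is `C²` if `x` is. [folklore] -/
theorem rescale_contDiff {x : ℝ → EuclideanSpace ℝ (Fin 3)} {n : ℕ∞} (hx : ContDiff ℝ n x) (G : ℝ) :
    ContDiff ℝ n (fun s : ℝ => G⁻¹ • x (G * s)) :=
  (hx.comp (contDiff_const.mul contDiff_id)).const_smul G⁻¹

/-- Kernel scaling: `((‖G⁻¹•a‖² + G⁻²)^{3/2})⁻¹ = G³ ((‖a‖² + 1)^{3/2})⁻¹` (`G > 0`). [folklore] -/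
theorem rescale_kernel (a : EuclideanSpace ℝ (Fin 3)) {G : ℝ} (hG : 0 < G) :
    ((‖G⁻¹ • a‖ ^ 2 + (G⁻¹) ^ 2) ^ (3 / 2 : ℝ))⁻¹ = G ^ 3 * ((‖a‖ ^ 2 + 1) ^ (3 / 2 : ℝ))⁻¹ := by
  have hGi : 0 < G⁻¹ := inv_pos.2 hG
  have hn : ‖G⁻¹ • a‖ = G⁻¹ * ‖a‖ := by rw [norm_smul, Real.norm_eq_abs, abs_of_pos hGi]
  have hbase : ‖G⁻¹ • a‖ ^ 2 + (G⁻¹) ^ 2 = (G⁻¹) ^ 2 * (‖a‖ ^ 2 + 1) := by rw [hn]; ring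
  rw [hbase, Real.mul_rpow (by positivity) (by positivity)]
  have hp : ((G⁻¹) ^ 2) ^ (3 / 2 : ℝ) = (G⁻¹) ^ 3 := by
    rw [show ((G⁻¹) ^ 2 : ℝ) = (G⁻¹) ^ (2 : ℝ) by norm_cast, ← Real.rpow_mul hGi.le,
      show (2 : ℝ) * (3 / 2) = (3 : ℕ) by norm_num, Real.rpow_natCast]
  rw [hp, mul_inv, inv_pow, inv_inv]

/-- **Change of units for the self-induction integral.**  For a differentiable curve `x`, `G > 0`, `X s = G⁻¹ • x (G s)`:
`∫ ((‖x t − x u‖²+1)^{3/2})⁻¹ • x′u × (x t − x u) du = G⁻¹ • ∫ ((‖X(t/G) − X s‖² + G⁻²)^{3/2})⁻¹ • X′s × (X(t/G) − X s) ds`.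
[folklore] -/
theorem selfInduction_rescale {x : ℝ → EuclideanSpace ℝ (Fin 3)} (hx : Differentiable ℝ x) {G : ℝ} (hG : 0 < G)
    (X : ℝ → EuclideanSpace ℝ (Fin 3)) (hX : X = fun s : ℝ => G⁻¹ • x (G * s)) (t : ℝ) :
    (∫ u : ℝ, ((‖x t - x u‖ ^ 2 + 1) ^ (3 / 2 : ℝ))⁻¹ • cross (deriv x u) (x t - x u)) =
      G⁻¹ • ∫ s : ℝ, ((‖X (t / G) - X s‖ ^ 2 + (G⁻¹) ^ 2) ^ (3 / 2 : ℝ))⁻¹ • cross (deriv X s) (X (t / G) - X s) := by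
  have hG0 : G ≠ 0 := hG.ne'
  have hXd : deriv X = fun s => deriv x (G * s) := by rw [hX]; exact rescale_deriv hx hG0
  have hXt : X (t / G) = G⁻¹ • x t := by rw [hX]; dsimp only; rw [mul_div_cancel₀ t hG0]
  -- the rescaled integrand is `G² •` the original one at `u = G s`
  have hpt : ∀ s : ℝ, ((‖X (t / G) - X s‖ ^ 2 + (G⁻¹) ^ 2) ^ (3 / 2 : ℝ))⁻¹ • cross (deriv X s) (X (t / G) - X s) =
      G ^ 2 • (((‖x t - x (G * s)‖ ^ 2 + 1) ^ (3 / 2 : ℝ))⁻¹ • cross (deriv x (G * s)) (x t - x (G * s))) := by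
    intro s
    have hdiff : X (t / G) - X s = G⁻¹ • (x t - x (G * s)) := by
      rw [hXt, hX]; dsimp only; rw [smul_sub]
    rw [hdiff, hXd]; dsimp only
    rw [rescale_kernel _ hG, ← crossCLM_apply, map_smul, crossCLM_apply, smul_smul, smul_smul]
    congr 1
    field_simp
  have hfun : (fun s : ℝ => ((‖X (t / G) - X s‖ ^ 2 + (G⁻¹) ^ 2) ^ (3 / 2 : ℝ))⁻¹ • cross (deriv X s) (X (t / G) - X s)) =
      fun s : ℝ => G ^ 2 • (fun u : ℝ => ((‖x t - x u‖ ^ 2 + 1) ^ (3 / 2 : ℝ))⁻¹ • cross (deriv x u) (x t - x u)) (G * s) :=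
    funext hpt
  rw [hfun, integral_smul, MeasureTheory.Measure.integral_comp_mul_left
    (fun u : ℝ => ((‖x t - x u‖ ^ 2 + 1) ^ (3 / 2 : ℝ))⁻¹ • cross (deriv x u) (x t - x u)) G,
    abs_of_pos (inv_pos.2 hG), smul_smul, smul_smul]
  rw [show G⁻¹ * G ^ 2 * G⁻¹ = 1 by field_simp, one_smul]

end SelectionBoxRJRung

end Summit.NavierStokesRegularity.NavierStokesRegularity.Theorems
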